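import Literature.MathematicalPhysics.QuantumFieldTheory.Balaban1983to89.B16Ineq19FlatSliceChart
import Literature.MathematicalPhysics.QuantumFieldTheory.Balaban1983to89.B11Eq177CriticalFamilyDerivative

/-!
# `Balaban1983to89.B16Ineq19FlatSliceNondegenerate` — T. Bałaban, *Large field renormalization. II*, Commun. Math. Phys. **122** (1989) 355–392
# [Balaban1989LargeFieldII], p. 359: «Denote by P₀ the projection onto the subspace of B′ satisfying the gauge condition B′↾G₀ = 0. By the inequality (1.9) the
# operator P₀H*_{1,k}Δ₁H_{1,k}P₀ is positive, hence invertible on this subspace» — THE NONDEGENERACY LETTER OF THE U2b THEOREMS DISCHARGED AT THE FLAT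
# BACKGROUND (bare-action currency): for every constraint chart whose linearised kernel lies in the axial-gauge slice, the flat Lagrangian Hessian is
# nondegenerate on that kernel; hence the U2b identity «derivative of the family = `H` for ANY `H` with [15] Sect. C's two flat conditions» holds there with NO
# positivity hypothesis.  PROVED (assembly of `B16Ineq19FlatSliceChart` + `B11Eq177CriticalFamilyDerivative`).

Honest framing: statement-level skeleton of published theorems with citation tags; proofs where landed; nothing here is a claim about the
Yang–Mills mass gap.

Cell `pub-ymgap` (HUMAN RULINGS D-0062 ∕ D-0149), WIDTH SEAT `pub-ymgap-dag-n12-w3` g0 (node N12 = [B15]; key K1⁷ `stmt-QuantumFields-20542`, `--kind proof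
--supports …`; count-neutral).  The two imported modules are this seat's (p590268, p588036∕v1.3); nothing else is modified.

WHAT THIS FILE PROVES (theorems only; no `def`, no `instance`, no `sorry`; axioms standard).  With n12-c's slice data of record (`S = castSite″(box n lo)`,
the `x₁`-axial tree `T`, margins `n_κ + 5 < sitesPerDir k`, sides `n₀, n₁ ≤ K`), any `ℝ³ ≅ 𝔰𝔲(2)` coordinate `φ` (`↑(φ v) = quatMatrix (ι v)`), and ANY map
`Ψ : (bonds → 𝔰𝔲(2)) → V` whose linearised kernel at `0` lies in the slice image `{φ ∘ ιA X}`: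
* ★★ `hnd_flat_of_ker_subset_slice` — the `hnd` binder of `B11Eq177CriticalFamilyDerivative.fderiv_flatCriticalExpChartFamily_eq` ∕ `…_class6` at `U₀ = 1`:
  `d ∈ ker DΨ(0)`, `D²(A∘expChart 1)(0)(d, ker DΨ(0)) = 0` ⇒ `d = 0` (take `t = d`: the flat second variation on `d = φιA X` is `≥ ‖X‖²∕(3K² + 2K⁴)`).
* ★★★ `fderiv_flatCriticalExpChartFamily_eq_of_ker_subset_slice` — the U2b identity at the flat background WITH THE NONDEGENERACY LETTER DISCHARGED: for every
  family `g ↦ X g` of 𝔰𝔲(2)-fields differentiable at `g₀` through `0`, tangent-critical on its fibres near `g₀`, `DΨ(0)` onto, and every `H` with the two FLAT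
  conditions, `X′(g₀) h = H (DΨ(0)(X′ h))`.

HONEST SCOPE.  k = 0 ∕ un-averaged currency (the slice and the action on the same lattice `T^{(k)}`), `SU(2)`, the ONTO letter and the differentiable family remain
hypotheses (n07-e's submersion chart; the (2.12) minimiser of record vs w1's constructed branch); for `k ≥ 1` the relevant form is the VALUE Hessian (`hessian_wilsonAction4_flat_expChartFamily`)
and its coarse comparison is U2c.  Count-neutral; N12 NOT discharged; the YM mass gap (Clay) is NOT proved by any of this — R4 closes only the conditional finite-𝕋⁴ rung
`BalabanLadder.UV`; nothing continuum ∕ OS.  0 kit, 0 lit wants.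

## References
* [Balaban1989LargeFieldII] T. Bałaban, Commun. Math. Phys. 122 (1989) 355–392: (1.9) p. 358, p. 359 (the sentence quoted above), (1.12)–(1.13) p. 359.
* [Balaban1985Variational] T. Bałaban, Commun. Math. Phys. 102 (1985) 277–309: (45)–(47) p. 285, (82)–(83) p. 290, (174)∕(177) pp. 305–306, Sect. E p. 300.
-/

noncomputable section

open Set Finset Filter Topology

namespace Literature.MathematicalPhysics.QuantumFieldTheory.Balaban1983to89.B16Ineq19FlatSliceNondegenerate

open T4Continuum B16Sect1Backgrounds B15DeterminingSets GaugeField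
open Literature.MathematicalPhysics.QuantumLattice (quatMatrix)
open T4HaarSU2ExpChart (imQuat)
open T4AdjointCovarianceUnitary (lieSU)
open T4CubeChartGnomonic (SU2)
open B15Prop1ChartSU2 (su2Chart)
open B15Prop1SliceCoordinates (GaugeSlice ιA)
open T4AxialGaugeSmallField (castSite)
open B6BondElimination (unitVec)
open B16Eq18Proof (box)
open Node00 (SU expChart)
open B16Ineq19FlatSliceChart B11Eq177CriticalFamilyDerivative
open scoped Matrix.Norms.L2Operator

variable {P : Params} {k : ℕ} [DecidableEq (PBond P k)]

/-- ★★ **THE NONDEGENERACY LETTER AT THE FLAT BACKGROUND, DISCHARGED ON THE AXIAL-GAUGE SLICE** ([LF-II] p. 359 «By the inequality (1.9) the operator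
P₀H*Δ₁HP₀ is positive, hence invertible on this subspace»): if the linearised kernel of the constraint chart `Ψ` at `0` lies in the slice image `{φ ∘ ιA X}`, then
every `d ∈ ker DΨ(0)` which is `D²(A∘expChart 1)(0)`-orthogonal to `ker DΨ(0)` is `0` — the binder `hnd` of
`B11Eq177CriticalFamilyDerivative.fderiv_flatCriticalExpChartFamily_eq`, with `λ₀ = 0`. [cite: Balaban1989LargeFieldII, (1.9) p.358, p.359; Balaban1985Variational, Sect. E p.300] -/
theorem hnd_flat_of_ker_subset_slice (h0 : 0 < P.d) (h1 : 1 < P.d) {lo : Fin P.d → ℤ} {n : Fin P.d → ℕ}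
    (hN : ∀ κ, (n κ : ℤ) + 5 < P.sitesPerDir k) {K : ℕ} (hK0 : n ⟨0, h0⟩ ≤ K) (hK1 : n ⟨1, h1⟩ ≤ K)
    {S : Set (Site P k)} {T : Finset (PBond P k)}
    (hS : S = castSite '' (↑(box n lo) : Set (Fin P.d → ℤ)))
    (hT : T = (box n lo).image fun x => (⟨castSite (x - unitVec ⟨0, h0⟩), ⟨0, h0⟩⟩ : PBond P k))
    {φ : EuclideanSpace ℝ (Fin 3) →ₗ[ℝ] lieSU (Fin 2)}
    (hφ : ∀ v, ((φ v : lieSU (Fin 2)) : Matrix (Fin 2) (Fin 2) ℂ) = quatMatrix (imQuat v))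
    {V : Type*} [NormedAddCommGroup V] [NormedSpace ℝ V] {Ψ : (PBond P k → lieSU (Fin 2)) → V}
    (hker : ∀ d, fderiv ℝ Ψ 0 d = 0 → ∃ X : GaugeSlice S T (EuclideanSpace ℝ (Fin 3)), d = fun b => φ (ιA S T X b))
    (d : PBond P k → lieSU (Fin 2)) (hd : fderiv ℝ Ψ 0 d = 0)
    (hq : ∀ t, fderiv ℝ Ψ 0 t = 0 →
      fderiv ℝ (fun Y => fderiv ℝ (fun Y : PBond P k → lieSU (Fin 2) => wilsonAction4 (expChart (1 : GaugeField P k (SU 2)) Y)) Y) 0 d t = 0) :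
    d = 0 := by
  obtain ⟨X, rfl⟩ := hker d hd
  -- the flat second variation on `d = φ ∘ ιA X` vanishes …
  have hzero : deriv (deriv fun s : ℝ => wilsonAction4 (expMul su2Chart (s • ιA S T X) (1 : GaugeField P k SU2))) 0 = 0 := by
    rw [deriv_deriv_wilsonAction4_expMul_su2Chart_one_eq_expChart hφ, deriv_deriv_wilsonAction4_expChart_smul_eq]
    exact hq _ hd
  -- … so `‖X‖² ≤ (3K² + 2K⁴) · 0`, i.e. `X = 0`
  have hle := sliceNormSq_le_secondVariation_flat h0 h1 hN hK0 hK1 hS hT X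
  rw [hzero, mul_zero] at hle
  have hX : X = 0 := by
    have : ‖X‖ ^ 2 = 0 := le_antisymm hle (by positivity)
    exact norm_eq_zero.1 (pow_eq_zero_iff two_ne_zero |>.1 this)
  subst hX
  funext b
  simp only [map_zero, Pi.zero_apply]

/-- ★★★ **U2b AT THE FLAT BACKGROUND WITH THE NONDEGENERACY LETTER DISCHARGED**: for ANY constraint chart `Ψ` whose linearised kernel at `0` lies in the axial-gauge slice
image and whose derivative at `0` is ONTO, ANY family `g ↦ X g` of 𝔰𝔲(2)-fields differentiable at `g₀` with `X g₀ = 0` whose members are tangent-critical on their fibres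
near `g₀`, and ANY map `H` with [15] Sect. C's two FLAT conditions (`DΨ(0) ∘ H = id`, `D²(A∘expChart 1)(0)(H y, ker DΨ(0)) = 0`): `X′(g₀) h = H (DΨ(0)(X′ h))` — the
linearised minimiser `H⁰_{1,k}` IS the derivative of the family, selection-free, no positivity hypothesis left (k = 0 ∕ bare-action currency).
[cite: Balaban1985Variational, (174) p.305, (177) p.306, (45)–(47) p.285, (82)–(83) p.290; Balaban1989LargeFieldII, (1.9) p.358, p.359, (1.12)–(1.13) p.359] -/
theorem fderiv_flatCriticalExpChartFamily_eq_of_ker_subset_slice (h0 : 0 < P.d) (h1 : 1 < P.d) {lo : Fin P.d → ℤ} {n : Fin P.d → ℕ}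
    (hN : ∀ κ, (n κ : ℤ) + 5 < P.sitesPerDir k) {K : ℕ} (hK0 : n ⟨0, h0⟩ ≤ K) (hK1 : n ⟨1, h1⟩ ≤ K)
    {S : Set (Site P k)} {T : Finset (PBond P k)}
    (hS : S = castSite '' (↑(box n lo) : Set (Fin P.d → ℤ)))
    (hT : T = (box n lo).image fun x => (⟨castSite (x - unitVec ⟨0, h0⟩), ⟨0, h0⟩⟩ : PBond P k))
    {φ : EuclideanSpace ℝ (Fin 3) →ₗ[ℝ] lieSU (Fin 2)}
    (hφ : ∀ v, ((φ v : lieSU (Fin 2)) : Matrix (Fin 2) (Fin 2) ℂ) = quatMatrix (imQuat v))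
    {V G : Type*} [NormedAddCommGroup V] [NormedSpace ℝ V] [FiniteDimensional ℝ V] [NormedAddCommGroup G] [NormedSpace ℝ G]
    {Ψ : (PBond P k → lieSU (Fin 2)) → V}
    (hker : ∀ d, fderiv ℝ Ψ 0 d = 0 → ∃ X : GaugeSlice S T (EuclideanSpace ℝ (Fin 3)), d = fun b => φ (ιA S T X b))
    {X : G → PBond P k → lieSU (Fin 2)} {g₀ : G} (hX₀ : X g₀ = 0) {X' : G →L[ℝ] PBond P k → lieSU (Fin 2)} (hX : HasFDerivAt X X' g₀)
    {Ψ₂ : (PBond P k → lieSU (Fin 2)) →L[ℝ] (PBond P k → lieSU (Fin 2)) →L[ℝ] V} (hΨ₂ : HasFDerivAt (fun Y => fderiv ℝ Ψ Y) Ψ₂ 0)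
    (hsurj : Function.Surjective (fderiv ℝ Ψ 0))
    (hcrit : ∀ᶠ g in 𝓝 g₀, ∀ t, fderiv ℝ Ψ (X g) t = 0 →
      fderiv ℝ (fun Y : PBond P k → lieSU (Fin 2) => wilsonAction4 (expChart (1 : GaugeField P k (SU 2)) Y)) (X g) t = 0)
    {H : V → PBond P k → lieSU (Fin 2)} (hLH : ∀ y, fderiv ℝ Ψ 0 (H y) = y)
    (hH : ∀ y t, fderiv ℝ Ψ 0 t = 0 →
      fderiv ℝ (fun Y => fderiv ℝ (fun Y : PBond P k → lieSU (Fin 2) => wilsonAction4 (expChart (1 : GaugeField P k (SU 2)) Y)) Y) 0 (H y) t = 0)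
    (h : G) : X' h = H (fderiv ℝ Ψ 0 (X' h)) :=
  fderiv_flatCriticalExpChartFamily_eq hX₀ hX hΨ₂ hsurj hcrit
    (fun d hd hq => hnd_flat_of_ker_subset_slice h0 h1 hN hK0 hK1 hS hT hφ hker d hd hq) hLH hH h

end Literature.MathematicalPhysics.QuantumFieldTheory.Balaban1983to89.B16Ineq19FlatSliceNondegenerate

end
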